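import Literature.Analysis.FluidPDE.CompressibleEulerProfileTemperateGrowth
import HarnessLib

/-!
# All derivatives of the exact self-similar solution blow up polynomially (theorems only)

Topic `Literature/Analysis/FluidPDE`; namespace `Literature.Analysis.FluidPDE.CaolaboraEtAl2025`.
Sequel of `CompressibleEulerProfileTemperateGrowth.lean` (the profile fields `Ū`, `S̄` of the
vendored fact `BuckmasterCaolaboraGomezserrano2025_thm11_monatomic` have temperate growth) and of
`CompressibleEulerExactSelfSimilarImplosion.lean` (the exact self-similar solution
`u = r⁻¹(T−t)^{1/r−1} Ū(x/(T−t)^{1/r})`, `σ = r⁻¹(T−t)^{1/r−1} S̄(x/(T−t)^{1/r})`).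
THEOREMS ONLY, no new facts (D-0026).

Clause 3 of the named fact `CaolaboraEtAl2025_thm12_rates` (Cao-Labora–Gómez-Serrano–Shi–
Staffilani, Thm 1.2: the solution is `C^∞` up to `T` with all derivatives `O((T−t)^{−p})`)
is, in the region where the periodic solution equals the exact self-similar one, the following
scaling computation: `∇ⁿ[F(e·)](x) = eⁿ (∇ⁿF)(ex)` (`norm_iteratedFDeriv_comp_smul_le`) and the
temperate bound `|∇ⁿF(y)| ≤ C(1+|y|)^k` give, with `e = (T−t)^{−1/r} ≥ T^{−1/r}` on `[0, T)`,

  `‖∇ⁿu(t,·)(x)‖, ‖∇ⁿσ(t,·)(x)‖ ≤ C (T−t)^{−p} (1 + |x|)^k`,  `p = 1 − 1/r + (n+k)/r`,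

for all `0 ≤ t < T` and ALL `x ∈ ℝ³` (`exactSolution_iteratedFDeriv_le`).
[cite: CaolaboraEtAl2025, Thm 1.2 p. 6 and eq. (1.6) p. 6; §1.3 p. 5 (self-similar change of variables)]
-/

noncomputable section

open Set Filter Topology
open scoped ContDiff

namespace Literature.Analysis.FluidPDE

open Literature.MathematicalPhysics.KineticTheory (V3)

namespace CaolaboraEtAl2025

/-! ### Scaling of iterated derivatives -/

section Scaling

variable {G : Type*} [NormedAddCommGroup G] [NormedSpace ℝ G]

/-- `‖∇ⁿ[F(e·)](x)‖ ≤ eⁿ ‖(∇ⁿF)(ex)‖` for smooth `F` and `e ≥ 0` (precomposition with the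
homothety `e · id`, of operator norm `≤ e`). [folklore] -/
theorem norm_iteratedFDeriv_comp_smul_le {F : V3 → G} (hF : ContDiff ℝ ∞ F) {e : ℝ} (he : 0 ≤ e)
    (n : ℕ) (x : V3) :
    ‖iteratedFDeriv ℝ n (fun x => F (e • x)) x‖ ≤ e ^ n * ‖iteratedFDeriv ℝ n F (e • x)‖ := by
  have hfun : (fun x => F (e • x)) = F ∘ (e • ContinuousLinearMap.id ℝ V3) := by
    funext x
    simp
  have h := ContinuousLinearMap.iteratedFDeriv_comp_right (e • ContinuousLinearMap.id ℝ V3)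
    (i := n) hF x (by exact_mod_cast le_top)
  rw [hfun, h]
  refine (ContinuousMultilinearMap.norm_compContinuousLinearMap_le _ _).trans ?_
  rw [Finset.prod_const, Finset.card_univ, Fintype.card_fin, mul_comm]
  have hL : ‖e • ContinuousLinearMap.id ℝ V3‖ ≤ e := by
    rw [norm_smul, Real.norm_eq_abs, abs_of_nonneg he]
    exact mul_le_of_le_one_right he ContinuousLinearMap.norm_id_le
  have h2 : ‖e • ContinuousLinearMap.id ℝ V3‖ ^ n ≤ e ^ n := pow_le_pow_left₀ (norm_nonneg _) hL n
  simpa using mul_le_mul_of_nonneg_right h2 (norm_nonneg (iteratedFDeriv ℝ n F _))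

end Scaling

/-! ### The exact solution -/

section Exact

variable {r T : ℝ} {U S : ℝ → ℝ} {Ub : V3 → V3} {Sb : V3 → ℝ} {u : ℝ → V3 → V3}
  {σ : ℝ → V3 → ℝ}

/-- **Polynomial blow-up of all derivatives of the exact self-similar solution, with polynomial
weights in space.** For the exact solution generated by a profile as in the vendored fact
`BuckmasterCaolaboraGomezserrano2025_thm11_monatomic` and every `n` there are `k`, `C`, `p` with
`‖∇ⁿu(t,·)(x)‖ ≤ C (T−t)^{−p}(1+|x|)^k` and `‖∇ⁿσ(t,·)(x)‖ ≤ C (T−t)^{−p}(1+|x|)^k` for all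
`0 ≤ t < T`, `x ∈ ℝ³` — the self-similar form of the statement of Thm 1.2 of the source that
the solution stays `C^∞` until `T` with polynomially bounded derivatives (clause 3 of
`CaolaboraEtAl2025_thm12_rates`, in the exact region).
[cite: CaolaboraEtAl2025, Thm 1.2 p. 6; eq. (1.6) p. 6; §1.3 p. 5] -/
theorem exactSolution_iteratedFDeriv_le (hr : 0 < r)
    (hU : ContDiff ℝ ∞ fun y : V3 => (U ‖y‖ / ‖y‖) • y) (hS : ContDiff ℝ ∞ fun y : V3 => S ‖y‖)
    (hode : ∀ ζ : ℝ, 0 < ζ →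
      (r - 1) * U ζ + (ζ + U ζ) * deriv U ζ + 1 / 3 * S ζ * deriv S ζ = 0 ∧
      (r - 1) * S ζ + (ζ + U ζ) * deriv S ζ + 1 / 3 * S ζ * (deriv U ζ + 2 * U ζ / ζ) = 0)
    (hlimU : Tendsto (fun ζ => U ζ / ζ) atTop (𝓝 0))
    (hlimS : Tendsto (fun ζ => S ζ / ζ) atTop (𝓝 0))
    (hUb : Ub = fun y : V3 => (U ‖y‖ / ‖y‖) • y) (hSb : Sb = fun y : V3 => S ‖y‖)
    (hu : ∀ t x, u t x = (r⁻¹ * (T - t) ^ (1 / r - 1)) • Ub ((T - t) ^ (-1 / r) • x))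
    (hσ : ∀ t x, σ t x = (r⁻¹ * (T - t) ^ (1 / r - 1)) * Sb ((T - t) ^ (-1 / r) • x))
    (hT : 0 < T) (n : ℕ) :
    ∃ (k : ℕ) (C p : ℝ), ∀ t ∈ Ico 0 T, ∀ x : V3,
      ‖iteratedFDeriv ℝ n (u t) x‖ ≤ C * (T - t) ^ (-p) * (1 + ‖x‖) ^ k ∧
        ‖iteratedFDeriv ℝ n (σ t) x‖ ≤ C * (T - t) ^ (-p) * (1 + ‖x‖) ^ k := by
  -- temperate bounds for the profile fields
  obtain ⟨k₁, C₁, hC₁⟩ := (hasTemperateGrowth_radialField hU hS hode hlimU hlimS).2 n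
  obtain ⟨k₂, C₂, hC₂⟩ := (hasTemperateGrowth_radialScalar hU hS hode hlimU hlimS).2 n
  have hUb' : ContDiff ℝ ∞ Ub := hUb ▸ hU
  have hSb' : ContDiff ℝ ∞ Sb := hSb ▸ hS
  set k : ℕ := k₁ + k₂ with hk
  have hC₁0 : 0 ≤ C₁ := by
    have h := hC₁ 0
    have h0 : (0 : ℝ) ≤ C₁ * (1 + ‖(0 : V3)‖) ^ k₁ := (norm_nonneg _).trans h
    simpa using h0
  have hC₂0 : 0 ≤ C₂ := by
    have h := hC₂ 0
    have h0 : (0 : ℝ) ≤ C₂ * (1 + ‖(0 : V3)‖) ^ k₂ := (norm_nonneg _).trans h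
    simpa using h0
  -- uniform temperate bounds with the common exponent `k`
  have hB1 : ∀ y : V3, ‖iteratedFDeriv ℝ n Ub y‖ ≤ C₁ * (1 + ‖y‖) ^ k := by
    intro y
    rw [hUb]
    refine (hC₁ y).trans (mul_le_mul_of_nonneg_left ?_ hC₁0)
    exact pow_le_pow_right₀ (by simp) (Nat.le_add_right _ _)
  have hB2 : ∀ y : V3, ‖iteratedFDeriv ℝ n Sb y‖ ≤ C₂ * (1 + ‖y‖) ^ k := by
    intro y
    rw [hSb]
    refine (hC₂ y).trans (mul_le_mul_of_nonneg_left ?_ hC₂0)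
    exact pow_le_pow_right₀ (by simp) (Nat.le_add_left _ _)
  -- constants
  set M : ℝ := max (T ^ (1 / r)) 1 with hM
  have hM1 : 1 ≤ M := le_max_right _ _
  set C : ℝ := r⁻¹ * max C₁ C₂ * M ^ k with hC
  set p : ℝ := 1 - 1 / r + (n + k) / r with hp
  refine ⟨k, C, p, fun t ht x => ?_⟩
  -- the powers of `l = T - t`
  have hl : 0 < T - t := sub_pos.2 ht.2
  have hlT : T - t ≤ T := by linarith [ht.1]
  set a : ℝ := r⁻¹ * (T - t) ^ (1 / r - 1) with ha
  set e : ℝ := (T - t) ^ (-1 / r) with he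
  have ha0 : 0 < a := mul_pos (inv_pos.2 hr) (Real.rpow_pos_of_pos hl _)
  have he0 : 0 < e := Real.rpow_pos_of_pos hl _
  -- `1 ≤ e T^{1/r}`, hence `1 + e‖x‖ ≤ e M (1 + ‖x‖)`
  have heT : 1 ≤ e * T ^ (1 / r) := by
    have h1 : e * T ^ (1 / r) = (T / (T - t)) ^ (1 / r) := by
      rw [he, Real.div_rpow hT.le hl.le, show (-1 / r : ℝ) = -(1 / r) by ring,
        Real.rpow_neg hl.le]
      ring
    rw [h1]
    exact Real.one_le_rpow ((one_le_div hl).2 hlT) (by positivity)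
  have hex : ∀ y : V3, 1 + ‖e • y‖ ≤ e * M * (1 + ‖y‖) := by
    intro y
    rw [norm_smul, Real.norm_eq_abs, abs_of_pos he0]
    have h1 : 1 + e * ‖y‖ ≤ e * T ^ (1 / r) + e * ‖y‖ := by linarith
    have h2 : e * T ^ (1 / r) + e * ‖y‖ = e * (T ^ (1 / r) + ‖y‖) := by ring
    have h3 : T ^ (1 / r) + ‖y‖ ≤ M * (1 + ‖y‖) := by
      have := le_max_left (T ^ (1 / r)) 1
      nlinarith [norm_nonneg y]
    calc 1 + e * ‖y‖ ≤ e * (T ^ (1 / r) + ‖y‖) := by rw [← h2]; exact h1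
      _ ≤ e * (M * (1 + ‖y‖)) := mul_le_mul_of_nonneg_left h3 he0.le
      _ = e * M * (1 + ‖y‖) := by ring
  -- the power of `T - t` collecting `a e^{n+k}`
  have hpow : a * e ^ (n + k) = r⁻¹ * (T - t) ^ (-p) := by
    have h1 : e ^ (n + k) = (T - t) ^ (-1 / r * ((n + k : ℕ) : ℝ)) := by
      rw [Real.rpow_mul hl.le, Real.rpow_natCast]
    rw [ha, h1, mul_assoc, ← Real.rpow_add hl]
    congr 2
    rw [hp]
    push_cast
    ring
  -- the generic estimate
  have key : ∀ {G : Type} [NormedAddCommGroup G] [NormedSpace ℝ G] {F : V3 → G} {CF : ℝ},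
      ContDiff ℝ ∞ F → 0 ≤ CF → (∀ y, ‖iteratedFDeriv ℝ n F y‖ ≤ CF * (1 + ‖y‖) ^ k) →
      ‖iteratedFDeriv ℝ n (fun x => a • F (e • x)) x‖ ≤
        r⁻¹ * CF * M ^ k * (T - t) ^ (-p) * (1 + ‖x‖) ^ k := by
    intro G _ _ F CF hF hCF hB
    have hFe : ContDiff ℝ ∞ fun x : V3 => F (e • x) := hF.comp (contDiff_const_smul e)
    rw [iteratedFDeriv_const_smul_apply' (hFe.contDiffAt.of_le (by exact_mod_cast le_top)), norm_smul,
      Real.norm_eq_abs, abs_of_pos ha0]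
    calc a * ‖iteratedFDeriv ℝ n (fun x => F (e • x)) x‖
        ≤ a * (e ^ n * ‖iteratedFDeriv ℝ n F (e • x)‖) :=
          mul_le_mul_of_nonneg_left (norm_iteratedFDeriv_comp_smul_le hF he0.le n x) ha0.le
      _ ≤ a * (e ^ n * (CF * (1 + ‖e • x‖) ^ k)) := by gcongr; exact hB _
      _ ≤ a * (e ^ n * (CF * (e * M * (1 + ‖x‖)) ^ k)) := by
          gcongr
          exact hex x
      _ = r⁻¹ * CF * M ^ k * (T - t) ^ (-p) * (1 + ‖x‖) ^ k := by
          rw [mul_pow, mul_pow, pow_add] at *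
          have := hpow
          rw [pow_add] at this
          linear_combination (CF * M ^ k * (1 + ‖x‖) ^ k) * this
  have hmax : ∀ {CF : ℝ}, CF ≤ max C₁ C₂ →
      r⁻¹ * CF * M ^ k * (T - t) ^ (-p) * (1 + ‖x‖) ^ k ≤ C * (T - t) ^ (-p) * (1 + ‖x‖) ^ k := by
    intro CF hCF
    rw [hC]
    have h0 : 0 ≤ r⁻¹ * M ^ k * (T - t) ^ (-p) * (1 + ‖x‖) ^ k := by positivity
    nlinarith
  constructor
  · have hfun : u t = fun x => a • Ub (e • x) := funext fun x => hu t x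
    rw [hfun]
    exact (key hUb' hC₁0 hB1).trans (hmax (le_max_left _ _))
  · have hfun : σ t = fun x => a • Sb (e • x) := funext fun x => by rw [hσ t x, smul_eq_mul]
    rw [hfun]
    exact (key hSb' hC₂0 hB2).trans (hmax (le_max_right _ _))

end Exact

end CaolaboraEtAl2025

end Literature.Analysis.FluidPDE
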